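import Summits.BirchSwinnertonDyer.BirchSwinnertonDyer.Theorems.ByReductionTypeAtTwoAdditivePinchK
import Summits.BirchSwinnertonDyer.BirchSwinnertonDyer.Theorems.ByReductionTypeAtTwoOrdEisensteinHalfShaDictionary
import Summits.BirchSwinnertonDyer.Rank1Residual.AdditivePotMult.ModelFreeClassTheorems
import Literature.NumberTheory.EllipticCurves.Greenberg1999.EulerCharacteristicNumberFieldAnyPrime
import Literature.NumberTheory.EllipticCurves.Kato2004.RationalDivisibilityCyclotomicFourAtTwo
import Literature.NumberTheory.EllipticCurves.PAdicLFunctionMinusConstantTermAtTwoProofs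
import Literature.NumberTheory.EllipticCurves.BSDQuadraticDescentArchimedeanProofs
import Literature.NumberTheory.EllipticCurves.ImaginaryPeriod
import Literature.NumberTheory.EllipticCurves.ComplexMultiplicationBurungaleFlachFiniteProofs
import Literature.NumberTheory.EllipticCurves.ComplexMultiplicationBurungaleFlachProofs
import Literature.NumberTheory.EllipticCurves.BSDQuadraticDescentShaOddPartProofs
import Literature.NumberTheory.QuadraticFields.ImaginaryQuadraticPrescribedSplitting
import HarnessLib

/-!
# Route `ByReductionTypeAtTwo` (rung K4), crux `AdditiveRankZeroAtTwo` (item stmt-BirchSwinnertonDyer-19098), LINE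
# `add-twist-overK`: the DESCENT OVER `K* = ℚ(i)` in the kernel — (II-K*)^C from Greenberg's Theorem 4.1 over a
# number field at `p = 2` (PRINT, `Greenberg1999.thm41_charValue_rankZero_numberField_anyPrime`), the interpolation
# of BOTH branches at `T = 0`, Pal's period relation and the Selmer/torsion cardinalities at analytic rank `0`
# (seat `bsd-2adic-addL2`, GEN 6; MEMO-5 §4, R79)

HONEST FRAMING (cell `bsd-2adic`, run/shared/lean/pub/bsd-2adic/, HUMAN RULINGS D-0036/D-0054/D-0074): THEOREMS ONLY (no
definition, no named fact introduced, nothing asserted, closes nothing). PARTITION: X5@2 ADDITIVE (B1·O1), quadratic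
sub-class with `d* = −1`, semistable twist GOOD ORDINARY at `2` (the habitat of the two door-ready classes 274032m,
265200dr) × p = 2 — types-the-object-of (the last memo-grade binder `hdesc` of the GEN-6 rungs DECOMPOSED into PRINT +
tree theorems + three elementary displayed identities); closes none.

WHAT IS PROVED. For `W` (the additive curve, `r_an = 0`), `Wd` (its semistable twist, good ordinary at `2`,
`W ≅ Wd^{(−1)}`), `K` imaginary quadratic with `d_K = −4` and `V := Wd.baseChange K` (a `K`-model of `W_K`):
* `bsdPeriod_twist_baseChange_mul_two` — `2·Ω(V/K) = Ω(Wd)·|Ω⁻(Wd)|` (tree: Milne's archimedean comparison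
  `realPeriod_mul_realPeriod_quadraticTwist_eq_mul_bsdPeriod` + Pal's `realPeriod_quadraticTwist_mul_sqrt_of_neg'`);
* `constantCoeff_cycGeneratorQi_unitRoot` — `(L⁺·L⁻_ω)(0) = (1 − α⁻¹)²[0]⁺_f · α⁻²([1/4]⁻_f − [3/4]⁻_f)` (tree:
  `constantCoeff_padicLFunction_unitRoot` + `constantCoeff_padicLFunctionMinusBranch_one_two_of_coeffField`);
* **`missingPPartOverCAt_twist_baseChange_of_greenbergK`** — the `2`-part of BSD for `V/K` in Dokchitser–Dokchitser's
  any-model currency (`AdditivePotMult.MissingPPartOverCAt V 2`) FROM: Greenberg Thm. 4.1 over `K` at `2` (`hGrF`,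
  PRINT), the `Λ_K`-main conjecture (I-K*) at ONE cyclotomic datum with generator `ϖ⁺ϖ⁻·L⁺L⁻_ω` (the pinch over `K`,
  `AddPinchK.cycMainConjectureOverK_of_pinchK`), the two Néron ratios `ϖ⁺Ω(Wd) = Ω⁺_f`, `ϖ⁻|Ω⁻(Wd)| = Ω⁻_f`, GZK,
  modularity, Milne any-model (finiteness of `Ш(V)`), and THREE displayed elementary identities: `hL4` (Birch's formula
  for `χ₋₄` + "`L(Wd^{(−1)}, s) = L(f_{Wd}, χ₋₄, s)`": `2·L(W,1) = ±([1/4]⁻ − [3/4]⁻)·Ω⁻_f`, PRINT-shaped, MTT §I.8 (8.6)),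
  `hgoodK`/`hredK` (the base change is good ordinary at the prime above `2` with `#Ẽ_w(𝔽₂)(2) = #Ẽ(𝔽₂)(2)` — residue
  degree `1`), `hTam` (`ord₂ C(V/K, ω) = ord₂ ∏_w c_w(V)`: `V` is minimal at the prime above `2`, odd norms elsewhere).
  Proof = the ℚ-dictionary of `EisensteinShaCurrency.exists_shaAn_eq_and_valuation_constantCoeff_charGen_eq` run over
  `K`: `ord₂ g(0) + 2·ord₂ #V(K)(2) = ord₂ ∏c_w + 2·ord₂ #Ẽ(𝔽₂)(2) + ord₂ #Sel_{2^∞}(V/K)` (Greenberg),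
  `g(0) = ϖ⁺ϖ⁻·(1−α⁻¹)²[0]⁺·α⁻²S⁻` (interpolation), `#Sel = #Ш(V)(2)` (`card_selmerGroupPInfty_eq_card_primaryComponent_sha`,
  `V(K)` finite), `#Ш_an(V) = L(W,1)L(Wd,1)·#V(K)²/(Ω(V/K)·C(V))` (Artin `leadingLCoeff_models_eq`, `Reg = 1`)
  `= ±[0]⁺S⁻ϖ⁺ϖ⁻·#V(K)²/C(V)` — whence `ord₂ #Ш_an(V) = ord₂ #Ш(V)`.
* the composed door `bsdp_two_of_pinchK_greenbergK` is in the companion file `…AdditiveDescentKDoor.lean`.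

References: [GreenbergLNM1716] Thm. 4.1 (p. 102, general F); [MazurTateTeitelbaum1986Invent] §I.8 (8.6), §I.13–14;
[Pal2012] Thm. 3.2; [Milne1972ArithmeticAV] §1 Thm. 1; [DokchitserDokchitserAnnals2010] §2.1; [Kato2004Asterisque] Thm. 17.4.
-/

set_option autoImplicit false
-- the Theorems namespace of this sub repeats the summit name by design (D-0017 nested layout)
set_option linter.dupNamespace false

noncomputable section

open scoped Classical MatrixGroups ModularForm NumberField

open CongruenceSubgroup WeierstrassCurve IsDedekindDomain Literature.NumberTheory.EllipticCurves
  Literature.NumberTheory.EllipticCurves.ModularForms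
  Literature.NumberTheory.EllipticCurves.Rank1Residual
  Literature.NumberTheory.EllipticCurves.Rank1Residual.Typed
  Literature.NumberTheory.EllipticCurves.Greenberg1999
  Literature.NumberTheory.QuadraticFields
  Summit.BirchSwinnertonDyer.Rank1Residual.AdditivePotMult
  Summit.BirchSwinnertonDyer.Rank1Residual.X5.AddTwoL2
  Summit.BirchSwinnertonDyer.Rank1Residual.X5.AddTwoL2Cyc
  Summit.BirchSwinnertonDyer.Rank1Residual.X5.AddTwoL2Pinch

namespace Summit.BirchSwinnertonDyer.BirchSwinnertonDyer.Theorems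

namespace AddDescentK

/-! ## §1 The period of the base change to `ℚ(i)` -/

/-- **`2·Ω(Wd_K/K) = Ω(Wd)·|Ω⁻(Wd)|`** for `K` imaginary quadratic with `d_K = −4` (one complex place,
`Ω(·/K) = 2covol/√|d_K| = covol`): Milne's archimedean comparison `Ω(Wd)·Ω(Wd^{(d_K)}) = c_∞(Wd)·Ω(Wd_K/K)`
(tree `realPeriod_mul_realPeriod_quadraticTwist_eq_mul_bsdPeriod`) and Pal's `Ω(Wd^{(−4)})·√4 = c_∞(Wd)·|Ω⁻(Wd)|`
(tree `realPeriod_quadraticTwist_mul_sqrt_of_neg'`). [cite: Pal2012, Thm. 3.2 (case d < 0)]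
[cite: DokchitserDokchitserAnnals2010, §2.1 (the period over K)] -/
theorem bsdPeriod_twist_baseChange_mul_two (Wd : WeierstrassCurve ℚ) [Wd.IsElliptic] (K : Type) [Field K]
    [NumberField K] [NumberField.IsTotallyComplex K] (h2 : Module.finrank ℚ K = 2)
    (hdK : NumberField.discr K = -4) :
    (Wd.baseChange K).bsdPeriod * 2 = Wd.realPeriodRat * Wd.imaginaryPeriodRat := by
  haveI : (Wd.baseChange ℝ).IsElliptic := by rw [WeierstrassCurve.baseChange]; infer_instance
  have key := Wd.realPeriod_mul_realPeriod_quadraticTwist_eq_mul_bsdPeriod K h2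
  have htw : (Wd.quadraticTwist (NumberField.discr K : ℚ)).baseChange ℝ =
      (Wd.baseChange ℝ).quadraticTwist (-4 : ℝ) := by
    rw [Wd.baseChange_real_quadraticTwist, hdK]; norm_num
  have hPal := (Wd.baseChange ℝ).realPeriod_quadraticTwist_mul_sqrt_of_neg' (show (-4 : ℝ) < 0 by norm_num)
  have hsqrt : Real.sqrt (-(-4 : ℝ)) = 2 := by
    rw [neg_neg, show (4 : ℝ) = 2 ^ 2 by norm_num, Real.sqrt_sq (by norm_num : (0 : ℝ) ≤ 2)]
  rw [hsqrt] at hPal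
  rw [htw] at key
  have hn : (0 : ℝ) < (Wd.baseChange ℝ).numRealComponents := by
    exact_mod_cast (Wd.baseChange ℝ).numRealComponents_pos
  -- `Ω(Wd) · (c_∞ |Ω⁻| / 2) = c_∞ · bsdPeriod`
  have h1 : (Wd.baseChange ℝ).realPeriod * ((Wd.baseChange ℝ).numRealComponents * (Wd.baseChange ℝ).imaginaryPeriod) =
      (Wd.baseChange ℝ).numRealComponents * (Wd.baseChange K).bsdPeriod * 2 := by
    rw [← hPal, ← mul_assoc, key]
  rw [WeierstrassCurve.realPeriodRat_def, imaginaryPeriodRat_def]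
  have h2' : (Wd.baseChange ℝ).numRealComponents * ((Wd.baseChange K).bsdPeriod * 2) =
      (Wd.baseChange ℝ).numRealComponents * ((Wd.baseChange ℝ).realPeriod * (Wd.baseChange ℝ).imaginaryPeriod) := by
    linear_combination -h1
  exact mul_left_cancel₀ hn.ne' h2'

/-! ## §2 The constant term of the `Λ_{ℚ(i)}`-generator `L⁺·L⁻_ω` -/

/-- **`(L⁺·L⁻_ω)(0) = (1 − α⁻¹)²·[0]⁺_f · α⁻²·([1/4]⁻_f − [3/4]⁻_f)`** for the newform `f` of a curve `Wd`
good ordinary at `2` and its unit root `α` (tree: `constantCoeff_padicLFunction_unitRoot`, the plus interpolation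
at `T = 0`, and `constantCoeff_padicLFunctionMinusBranch_one_two_of_coeffField`, the odd one; the distribution
relation's inputs `2 ∤ N`, `a₂ = cuspCoeff f 2`, `α² − a₂α + 2 = 0` from `not_dvd_level_of_isNewformOf`,
`cuspCoeff_eq_frobeniusTrace_of_isNewformOf_holds`, `unitRoot_coe_spec`).
[cite: MazurTateTeitelbaum1986Invent, §I.13–I.14 (14.3)] -/
theorem constantCoeff_cycGeneratorQi_unitRoot (Wd : WeierstrassCurve ℚ) [Wd.IsElliptic] [Wd.IsGloballyMinimal]
    (hord : IsOrdinaryAt Wd 2) {N : ℕ} [NeZero N] {f : CuspForm (Gamma0 N) 2} (hf : IsNewformOf Wd f) :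
    PowerSeries.constantCoeff (padicLFunction f ((unitRoot Wd 2 : ℤ_[2]) : ℚ_[2]) *
        padicLFunctionMinusBranch f ((unitRoot Wd 2 : ℤ_[2]) : ℚ_[2]) 1) =
      (1 - ((unitRoot Wd 2 : ℤ_[2]) : ℚ_[2])⁻¹) ^ 2 * (ratPlusSymbol f 0 : ℚ_[2]) *
        (((unitRoot Wd 2 : ℤ_[2]) : ℚ_[2])⁻¹ ^ 2 *
          ((ratMinusSymbol f (1 / 4) : ℚ_[2]) - (ratMinusSymbol f (3 / 4) : ℚ_[2]))) := by
  obtain ⟨hαeq, _, hα0⟩ := unitRoot_coe_spec (W := Wd) hord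
  rw [map_mul, constantCoeff_padicLFunction_unitRoot hord hf,
    constantCoeff_padicLFunctionMinusBranch_one_two_of_coeffField f hf.1 hf.coeffField_eq_bot
      (not_dvd_level_of_isNewformOf hf hord.1) (cuspCoeff_eq_frobeniusTrace_of_isNewformOf_holds hf hord.1) hα0
      (by exact_mod_cast hαeq)]


/-! ## §3 The dictionary over `K = ℚ(i)`: (II-K*)^C from Greenberg 4.1 over `K`, interpolation and periods -/

section Dictionary

variable (W Wd : WeierstrassCurve ℚ) [W.IsElliptic] [W.IsGloballyMinimal] [Wd.IsElliptic] [Wd.IsGloballyMinimal]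
  (K : Type) [Field K] [NumberField K]

/-- **(II-K*)^C on `V = Wd_K` — the `2`-part of BSD over `K = ℚ(i)` for the base change of the SEMISTABLE
twist, from Greenberg's Theorem 4.1 over `K` (PRINT) and the `Λ_K`-main conjecture at ONE datum.** `W` = the
additive curve (`r_an = 0`), `Wd` = its twist, good ordinary at `2`, `r_an = 0`, `W ≅ Wd^{(−1)}`; `K` quadratic with
`d_K = −4`; `f` the newform of `Wd`, `α` its unit root, `ϖ⁺Ω(Wd) = Ω⁺_f`, `ϖ⁻|Ω⁻(Wd)| = Ω⁻_f`; a cyclotomic datum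
`(κ, γ, D)` over `K` with `X` torsion and `char X = (g)`, `ι g = ϖ⁺ϖ⁻·L⁺·L⁻_ω` (= (I-K*) at the datum). DISPLAYED
elementary identities: `hL4` (Birch for `χ₋₄` + the twist `L`-series: `2·L(W,1) = σ·([1/4]⁻ − [3/4]⁻)·Ω⁻_f`, `σ = ±1`),
`hgoodK` (good ordinary at the primes above `2` of `K`), `hredK` (`∏_{w∣2} #Ẽ_w(f_w)(2) = #Ẽ(𝔽₂)(2)`: one prime,
residue degree `1`), `hTam` (`ord₂ C(V) = ord₂ ∏ c_w`). Then `MissingPPartOverCAt (Wd.baseChange K) 2`.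
[cite: GreenbergLNM1716, Thm. 4.1 (p. 102)] [cite: MazurTateTeitelbaum1986Invent, §I.14 (14.3) and §I.8 (8.6)]
[cite: Pal2012, Thm. 3.2] [cite: DokchitserDokchitserAnnals2010, §2.1] -/
theorem missingPPartOverCAt_twist_baseChange_of_greenbergK
    (hGrF : Greenberg1999.thm41_charValue_rankZero_numberField_anyPrime)
    (hGZK : rank_eq_analyticRank_of_analyticRank_le_one) (hmod : hasEntireLFunction_rat)
    (hMilneC : Milne1972.bsdQuotient_baseChange_quadratic_anyModel)
    (hr : W.analyticRank = 0) (hrd : Wd.analyticRank = 0) (h2 : Module.finrank ℚ K = 2)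
    (hdK : NumberField.discr K = -4)
    (hWd : ∃ C : VariableChange ℚ, C • W.quadraticTwist (NumberField.discr K : ℚ) = Wd)
    (hWtw : ∃ C : VariableChange ℚ, C • Wd.quadraticTwist ((-1 : ℤ) : ℚ) = W)
    (hord : IsOrdinaryAt Wd 2) {N : ℕ} [NeZero N] {f : CuspForm (Gamma0 N) 2} (hf : IsNewformOf Wd f)
    {ϖp ϖm : ℚ} (hϖp : (ϖp : ℝ) * Wd.realPeriodRat = plusPeriod f)
    (hϖm : (ϖm : ℝ) * Wd.imaginaryPeriodRat = minusPeriod f) {σ : ℤ} (hσ : σ = 1 ∨ σ = -1)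
    (hL4 : W.entireLFunction 1 * 2 =
      (σ : ℂ) * ((((ratMinusSymbol f (1 / 4) - ratMinusSymbol f (3 / 4) : ℚ) : ℝ) * minusPeriod f : ℝ) : ℂ))
    (hgoodK : ∀ v : HeightOneSpectrum (𝓞 K), (2 : 𝓞 K) ∈ v.asIdeal →
      (Wd.baseChange K).HasGoodReductionAt v ∧ ¬ (2 : ℤ) ∣ (Wd.baseChange K).frobeniusTraceAt v)
    (hredK : (∏ᶠ v ∈ {v : HeightOneSpectrum (𝓞 K) | ((2 : ℕ) : 𝓞 K) ∈ v.asIdeal},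
        Nat.card (AddCommGroup.primaryComponent ((Wd.baseChange K).reductionAt v).toAffine.Point 2) : ℕ) =
      Nat.card (AddCommGroup.primaryComponent
        ((integralModelInt Wd).map (Int.castRingHom (ZMod 2))).toAffine.Point 2))
    (hTam : padicValRat 2 (Wd.baseChange K).modifiedTamagawaProduct =
      padicValNat 2 (Wd.baseChange K).tamagawaProduct)
    {κ : ZpExtension K 2} {γ : Field.absoluteGaloisGroup K} (hκ : κ.IsCyclotomic) (hγ : κ.IsTopGenerator γ)
    (D : (Wd.baseChange K).SelmerDualData κ γ) (hX : D.IsTorsion) {g : IwasawaAlgebra 2}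
    (hchar : D.charIdeal = Ideal.span {g})
    (hιg : iwasawaToPowerSeries 2 g = PowerSeries.C ((ϖp * ϖm : ℚ) : ℚ_[2]) *
      (padicLFunction f ((unitRoot Wd 2 : ℤ_[2]) : ℚ_[2]) *
        padicLFunctionMinusBranch f ((unitRoot Wd 2 : ℤ_[2]) : ℚ_[2]) 1)) :
    MissingPPartOverCAt (Wd.baseChange K) 2 := by
  haveI : Fact (Nat.Prime 2) := ⟨Nat.prime_two⟩
  haveI : (Wd.baseChange K).IsElliptic := by rw [WeierstrassCurve.baseChange]; infer_instance
  haveI : NumberField.IsTotallyComplex K := Quadratic.isTotallyComplex_of_discr_neg h2 (by rw [hdK]; norm_num)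
  -- Step 1: finiteness over `ℚ` (GZK at analytic rank 0)
  have hLW : W.entireLFunction 1 ≠ 0 :=
    (analyticRank_eq_zero_iff_L_one_ne_zero_of_hasEntireLFunction_rat hmod W).mp hr
  have hLD : Wd.entireLFunction 1 ≠ 0 :=
    (analyticRank_eq_zero_iff_L_one_ne_zero_of_hasEntireLFunction_rat hmod Wd).mp hrd
  obtain ⟨hrankW, hshaW⟩ := hGZK W (by rw [hr]; exact zero_le_one)
  obtain ⟨hrankD, hshaD⟩ := hGZK Wd (by rw [hrd]; exact zero_le_one)
  haveI hfinW : Finite W.toAffine.Point := W.finite_point_of_rank_zero (by rw [hrankW, hr])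
  haveI hfinD : Finite Wd.toAffine.Point := Wd.finite_point_of_rank_zero (by rw [hrankD, hrd])
  -- Step 2: `(Wd.baseChange K)(K)` finite
  obtain ⟨θ, hθ, hθ2⟩ := exists_sq_eq_discr_not_mem_range K h2
  have hdK' : ((-1 : ℤ) : ℚ) * (2 : ℚ) ^ 2 = (NumberField.discr K : ℚ) := by rw [hdK]; norm_num
  obtain ⟨C₁, hC₁⟩ := Wd.exists_variableChange_quadraticTwist_mul_sq ((-1 : ℤ) : ℚ) (2 : ℚ) two_ne_zero
  obtain ⟨C₂, hC₂⟩ := hWtw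
  have e₁ : (Wd.quadraticTwist ((-1 : ℤ) : ℚ)).toAffine.Point ≃+ W.toAffine.Point :=
    (VariableChange.pointEquiv (Wd.quadraticTwist ((-1 : ℤ) : ℚ)) C₂).trans (Affine.Point.congrEquiv hC₂)
  have hC₁' : C₁ • Wd.quadraticTwist ((-1 : ℤ) : ℚ) = Wd.quadraticTwist (NumberField.discr K : ℚ) := by
    rw [hC₁, hdK']
  have e₂ : (Wd.quadraticTwist ((-1 : ℤ) : ℚ)).toAffine.Point ≃+
      (Wd.quadraticTwist (NumberField.discr K : ℚ)).toAffine.Point :=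
    (VariableChange.pointEquiv (Wd.quadraticTwist ((-1 : ℤ) : ℚ)) C₁).trans (Affine.Point.congrEquiv hC₁')
  have eT : W.toAffine.Point ≃+ (Wd.quadraticTwist (NumberField.discr K : ℚ)).toAffine.Point := e₁.symm.trans e₂
  have hT : Finite (Wd.quadraticTwist (NumberField.discr K : ℚ)).toAffine.Point := Finite.of_equiv _ eT.toEquiv
  haveI hVfin : Finite (Wd.baseChange K).toAffine.Point :=
    WeierstrassCurve.finite_point_baseChange_of_finite_of_finite_quadraticTwist Wd h2 hθ hθ2 hfinD hT
  -- Step 3: `(Wd.baseChange K)` is a `K`-model of `W_K`; Milne (any model): `Ш((Wd.baseChange K))` finite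
  have hd4 : 4 * (-1 : ℤ) = NumberField.discr K := by rw [hdK]; norm_num
  obtain ⟨C₃, hC₃⟩ := AddPinchK.exists_variableChange_baseChange_of_twist W Wd K h2 hd4 ⟨C₂, hC₂⟩
  have hV : ∃ C : VariableChange K, C • W.baseChange K = (Wd.baseChange K) := ⟨C₃⁻¹, by rw [← hC₃, inv_smul_smul]⟩
  obtain ⟨hshaK, hWR⟩ := hMilneC W K h2 Wd hWd (Wd.baseChange K) hV hshaW hshaD
  haveI : Finite (Wd.baseChange K).sha := hshaK
  have hShpfin : Finite (AddCommGroup.primaryComponent (Wd.baseChange K).sha 2) := Finite.of_injective _ Subtype.val_injective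
  -- Step 4: Selmer = Ш(2) (`(Wd.baseChange K)(K)` finite)
  have hSel : Nat.card ((Wd.baseChange K).selmerGroupPInfty 2) = Nat.card (AddCommGroup.primaryComponent (Wd.baseChange K).sha 2) :=
    card_selmerGroupPInfty_eq_card_primaryComponent_sha (Wd.baseChange K) 2
  have hSelfin : Finite ((Wd.baseChange K).selmerGroupPInfty 2) :=
    Nat.finite_of_card_ne_zero (by rw [hSel]; exact Nat.card_pos.ne')
  haveI : Module.Finite (IwasawaAlgebra 2) D.X := SelmerDualData.module_finite_holds D hγ
  -- Step 5: Greenberg Thm. 4.1 over `K` at `2` (PRINT) at the datum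
  obtain ⟨u₁, hu₁⟩ := hGrF K (Wd.baseChange K) 2 hgoodK κ γ hκ hγ D hX g hchar hSelfin
  rw [hredK] at hu₁
  -- Step 6: interpolation of both branches at `T = 0`
  set a : ℚ_[2] := ((unitRoot Wd 2 : ℤ_[2]) : ℚ_[2]) with ha
  set sp : ℚ := ratPlusSymbol f 0 with hsp
  set sm : ℚ := ratMinusSymbol f (1 / 4) - ratMinusSymbol f (3 / 4) with hsm
  have hg0Q : ((PowerSeries.constantCoeff g : ℤ_[2]) : ℚ_[2]) =
      ((ϖp * ϖm : ℚ) : ℚ_[2]) * ((1 - a⁻¹) ^ 2 * (sp : ℚ_[2]) * (a⁻¹ ^ 2 * (sm : ℚ_[2]))) := by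
    rw [← constantCoeff_iwasawaToPowerSeries 2 g, hιg, map_mul, PowerSeries.constantCoeff_C,
      constantCoeff_cycGeneratorQi_unitRoot Wd hord hf, hsm]
    push_cast
    ring
  -- bridges `1 - a⁻¹ = u₂ · #Ẽ(𝔽₂)`, `#Ẽ(𝔽₂) = u₃ · #Ẽ(𝔽₂)(2)`, `a = unit`
  obtain ⟨u₂, hu₂⟩ := exists_unit_one_sub_unitRoot_inv 2 Wd hord
  haveI : NeZero (2 : ℕ) := ⟨two_ne_zero⟩
  obtain ⟨u₃, hu₃⟩ := exists_unit_natCard_eq_mul_card_primaryComponent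
    ((integralModelInt Wd).map (Int.castRingHom (ZMod 2))).toAffine.Point 2
  set Np : ℚ_[2] := (Nat.card (AddCommGroup.primaryComponent
    ((integralModelInt Wd).map (Int.castRingHom (ZMod 2))).toAffine.Point 2) : ℚ_[2]) with hNp
  have hNcount : (Wd.reductionPointCount 2 : ℚ_[2]) = ((u₃ : ℤ_[2]) : ℚ_[2]) * Np := by
    rw [WeierstrassCurve.reductionPointCount, hNp]
    exact hu₃
  have hNp0 : Np ≠ 0 := by rw [hNp]; exact_mod_cast Nat.card_pos.ne'
  have h1 : (1 - a⁻¹) = ((u₂ : ℤ_[2]) : ℚ_[2]) * ((u₃ : ℤ_[2]) : ℚ_[2]) * Np := by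
    rw [ha, hu₂, hNcount, mul_assoc]
  obtain ⟨-, hunit⟩ := unitRoot_spec_holds Wd 2 hord
  have haU : a = ((hunit.unit : ℤ_[2]ˣ) : ℤ_[2]) := by rw [ha, IsUnit.unit_spec]
  have ha0 : a ≠ 0 := by rw [haU]; exact coe_units_ne_zero 2 _
  -- non-vanishing of the analytic factors
  have hsp0 : sp ≠ 0 := by
    intro h0
    apply hLD
    rw [hf.entireLFunction_one_eq, ← hsp, h0]
    simp
  have hΩm : 0 < minusPeriod f := IsNewform0.minusPeriod_pos_holds hf.1 hf.coeffField_eq_bot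
  have hΩp : 0 < plusPeriod f := IsNewform0.plusPeriod_pos_holds hf.1 hf.coeffField_eq_bot
  have hσ0 : (σ : ℚ) ≠ 0 := by rcases hσ with h | h <;> simp [h]
  have hsm0 : sm ≠ 0 := by
    intro h0
    apply hLW
    have h := hL4
    rw [h0] at h
    simp only [Rat.cast_zero, zero_mul, Complex.ofReal_zero, mul_zero, mul_eq_zero, OfNat.ofNat_ne_zero,
      or_false] at h
    exact h
  have hϖp0 : ϖp ≠ 0 := by
    rintro rfl
    rw [Rat.cast_zero, zero_mul] at hϖp
    exact hΩp.ne hϖp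
  have hϖm0 : ϖm ≠ 0 := by
    rintro rfl
    rw [Rat.cast_zero, zero_mul] at hϖm
    exact hΩm.ne hϖm
  -- Step 7: cardinality bridges over `K`
  obtain ⟨u₄, hu₄⟩ := exists_unit_natCard_eq_mul_card_primaryComponent (Wd.baseChange K).toAffine.Point 2
  obtain ⟨u₅, hu₅⟩ := exists_unit_natCard_eq_mul_card_primaryComponent (Wd.baseChange K).sha 2
  set v := padicValNat 2 (Wd.baseChange K).tamagawaProduct with hv
  set Tp : ℚ_[2] := (Nat.card (AddCommGroup.primaryComponent (Wd.baseChange K).toAffine.Point 2) : ℚ_[2]) with hTp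
  set Shp : ℚ_[2] := (Nat.card (AddCommGroup.primaryComponent (Wd.baseChange K).sha 2) : ℚ_[2]) with hShp
  have htors : (Wd.baseChange K).torsionOrder = Nat.card (Wd.baseChange K).toAffine.Point := (Wd.baseChange K).torsionOrder_eq_natCard_of_finite
  have hu₄' : ((Wd.baseChange K).torsionOrder : ℚ_[2]) = ((u₄ : ℤ_[2]) : ℚ_[2]) * Tp := by rw [htors, hTp]; exact hu₄
  have hSha : ((Wd.baseChange K).shaOrder : ℚ_[2]) = ((u₅ : ℤ_[2]) : ℚ_[2]) * Shp := by
    rw [WeierstrassCurve.shaOrder, hShp]; exact hu₅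
  have hSel' : (Nat.card ((Wd.baseChange K).selmerGroupPInfty 2) : ℚ_[2]) = Shp := by rw [hShp, hSel]
  have hTp0 : Tp ≠ 0 := by rw [hTp]; exact_mod_cast Nat.card_pos.ne'
  have hShp0 : Shp ≠ 0 := by rw [hShp]; exact_mod_cast Nat.card_pos.ne'
  rw [hSel'] at hu₁
  have h20 : ((2 : ℕ) : ℚ_[2]) ≠ 0 := Nat.cast_ne_zero.mpr two_ne_zero
  have hg0Q0 : ((PowerSeries.constantCoeff g : ℤ_[2]) : ℚ_[2]) ≠ 0 := by
    intro h0'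
    have := hu₁
    rw [h0', zero_mul] at this
    exact (mul_ne_zero (mul_ne_zero (mul_ne_zero (coe_units_ne_zero 2 u₁) (pow_ne_zero v h20))
      (pow_ne_zero 2 hNp0)) hShp0) this.symm
  -- Step 8: valuations
  have hv2 : ((2 : ℕ) : ℚ_[2]).valuation = 1 := Padic.valuation_p
  have hvT : Tp.valuation = (padicValNat 2 (Wd.baseChange K).torsionOrder : ℤ) := by
    have h := congrArg Padic.valuation hu₄'
    rw [Padic.valuation_natCast, Padic.valuation_mul (coe_units_ne_zero 2 u₄) hTp0,
      valuation_coe_units_eq_zero, zero_add] at h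
    exact h.symm
  have hvS : Shp.valuation = (padicValNat 2 (Wd.baseChange K).shaOrder : ℤ) := by
    have h := congrArg Padic.valuation hSha
    rw [Padic.valuation_natCast, Padic.valuation_mul (coe_units_ne_zero 2 u₅) hShp0,
      valuation_coe_units_eq_zero, zero_add] at h
    exact h.symm
  -- Greenberg: `ord₂ g(0) + 2·tors = v + 2·ord₂ Np + sha`
  have hvalG : ((PowerSeries.constantCoeff g).valuation : ℤ) + 2 * (padicValNat 2 (Wd.baseChange K).torsionOrder : ℤ) =
      v + 2 * Np.valuation + (padicValNat 2 (Wd.baseChange K).shaOrder : ℤ) := by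
    have h := congrArg Padic.valuation hu₁
    rw [Padic.valuation_mul hg0Q0 (pow_ne_zero 2 hTp0), Padic.valuation_pow,
      Padic.valuation_mul (mul_ne_zero (mul_ne_zero (coe_units_ne_zero 2 u₁) (pow_ne_zero v h20))
        (pow_ne_zero 2 hNp0)) hShp0,
      Padic.valuation_mul (mul_ne_zero (coe_units_ne_zero 2 u₁) (pow_ne_zero v h20))
        (pow_ne_zero 2 hNp0),
      Padic.valuation_mul (coe_units_ne_zero 2 u₁) (pow_ne_zero v h20), valuation_coe_units_eq_zero,
      Padic.valuation_pow, Padic.valuation_pow, hv2, hvT, hvS, PadicInt.valuation_coe] at h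
    push_cast at h ⊢
    linarith
  -- interpolation: `ord₂ g(0) = ord₂ ϖ⁺ + ord₂ ϖ⁻ + 2·ord₂ Np + ord₂ s⁺ + ord₂ S⁻`
  have hspQ0 : (sp : ℚ_[2]) ≠ 0 := by exact_mod_cast hsp0
  have hsmQ0 : (sm : ℚ_[2]) ≠ 0 := by exact_mod_cast hsm0
  have hϖQ0 : ((ϖp * ϖm : ℚ) : ℚ_[2]) ≠ 0 := by exact_mod_cast mul_ne_zero hϖp0 hϖm0
  have hU0 : ((u₂ : ℤ_[2]) : ℚ_[2]) * ((u₃ : ℤ_[2]) : ℚ_[2]) ≠ 0 :=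
    mul_ne_zero (coe_units_ne_zero 2 u₂) (coe_units_ne_zero 2 u₃)
  have h1a0 : (1 - a⁻¹) ≠ 0 := by rw [h1]; exact mul_ne_zero hU0 hNp0
  have hainv : a⁻¹ ≠ 0 := inv_ne_zero ha0
  have hva : a.valuation = 0 := by rw [haU]; exact valuation_coe_units_eq_zero 2 _
  have hvalg0 : ((PowerSeries.constantCoeff g).valuation : ℤ) =
      padicValRat 2 (ϖp * ϖm) + 2 * Np.valuation + padicValRat 2 sp + padicValRat 2 sm := by
    have h := congrArg Padic.valuation hg0Q
    rw [PadicInt.valuation_coe,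
      Padic.valuation_mul hϖQ0 (mul_ne_zero (mul_ne_zero (pow_ne_zero 2 h1a0) hspQ0)
        (mul_ne_zero (pow_ne_zero 2 hainv) hsmQ0)),
      Padic.valuation_mul (mul_ne_zero (pow_ne_zero 2 h1a0) hspQ0) (mul_ne_zero (pow_ne_zero 2 hainv) hsmQ0),
      Padic.valuation_mul (pow_ne_zero 2 h1a0) hspQ0, Padic.valuation_mul (pow_ne_zero 2 hainv) hsmQ0,
      Padic.valuation_pow, Padic.valuation_pow, h1, Padic.valuation_mul hU0 hNp0,
      Padic.valuation_mul (coe_units_ne_zero 2 u₂) (coe_units_ne_zero 2 u₃),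
      valuation_coe_units_eq_zero, valuation_coe_units_eq_zero, Padic.valuation_inv, hva,
      Padic.valuation_ratCast, Padic.valuation_ratCast, Padic.valuation_ratCast] at h
    push_cast at h ⊢
    linarith
  -- Step 9: `#Ш_an((Wd.baseChange K)) = σ · s⁺ · S⁻ · ϖ⁺ϖ⁻ · #(Wd.baseChange K)(K)² / C((Wd.baseChange K))` (Artin, periods, `Reg = 1`)
  have hL := leadingLCoeff_models_eq W K Wd (Wd.baseChange K) hmod h2 hWd hV
  have hReg : (Wd.baseChange K).regulator = 1 := (Wd.baseChange K).regulator_eq_one_of_finite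
  have hperK := bsdPeriod_twist_baseChange_mul_two Wd K h2 hdK
  have hΩW : (0 : ℝ) < Wd.realPeriodRat := Wd.realPeriodRat_pos_holds
  have hΩi : (0 : ℝ) < Wd.imaginaryPeriodRat := Wd.imaginaryPeriodRat_pos
  have hCK : ((Wd.baseChange K).modifiedTamagawaProduct : ℝ) ≠ 0 := by
    intro h0
    have hB : 0 < W.bsdRHS * Wd.bsdRHS := mul_pos (W.bsdRHS_pos' hshaW) (Wd.bsdRHS_pos' hshaD)
    rw [h0, mul_zero, zero_div] at hWR
    exact hB.ne hWR
  have hCK' : (Wd.baseChange K).modifiedTamagawaProduct ≠ 0 := by exact_mod_cast hCK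
  set q : ℚ := σ * sp * sm * (ϖp * ϖm) * ((Wd.baseChange K).torsionOrder : ℚ) ^ 2 / (Wd.baseChange K).modifiedTamagawaProduct with hq
  have hshaAn : shaAnOverC (Wd.baseChange K) = (q : ℂ) := by
    have hLW' : W.leadingLCoeff = W.entireLFunction 1 := W.leadingLCoeff_eq_of_analyticRank_eq_zero hr
    have hLD' : Wd.leadingLCoeff = Wd.entireLFunction 1 := Wd.leadingLCoeff_eq_of_analyticRank_eq_zero hrd
    have hLWv : W.entireLFunction 1 = (σ : ℂ) * (((sm : ℝ) * minusPeriod f : ℝ) : ℂ) / 2 := by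
      rw [← hL4]; ring
    rw [shaAnOverC, hL, hLW', hLD', hLWv, hf.entireLFunction_one_eq, hReg, ← hsp, ← hϖp, ← hϖm]
    have hper : ((Wd.baseChange K).bsdPeriod : ℂ) = ((Wd.realPeriodRat * Wd.imaginaryPeriodRat / 2 : ℝ) : ℂ) := by
      congr 1
      rw [← hperK]; ring
    rw [hper, hq]
    have hΩW' : (Wd.realPeriodRat : ℂ) ≠ 0 := by exact_mod_cast hΩW.ne'
    have hΩi' : (Wd.imaginaryPeriodRat : ℂ) ≠ 0 := by exact_mod_cast hΩi.ne'
    have hCKc : (((Wd.baseChange K).modifiedTamagawaProduct : ℚ) : ℂ) ≠ 0 := by exact_mod_cast hCK'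
    push_cast
    field_simp
  -- Step 10: `ord₂ q = ord₂ #Ш((Wd.baseChange K))`
  have htorsQ : ((Wd.baseChange K).torsionOrder : ℚ) ≠ 0 := by
    rw [htors]; exact_mod_cast (Nat.card_pos (α := (Wd.baseChange K).toAffine.Point)).ne'
  have hq0 : q ≠ 0 := by
    rw [hq]
    exact div_ne_zero (mul_ne_zero (mul_ne_zero (mul_ne_zero (mul_ne_zero hσ0 hsp0) hsm0)
      (mul_ne_zero hϖp0 hϖm0)) (pow_ne_zero 2 htorsQ)) hCK'
  have hvσ : padicValRat 2 (σ : ℚ) = 0 := by rcases hσ with h | h <;> simp [h]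
  have hvq : padicValRat 2 q = padicValRat 2 sp + padicValRat 2 sm + padicValRat 2 (ϖp * ϖm) +
      2 * (padicValNat 2 (Wd.baseChange K).torsionOrder : ℤ) - v := by
    rw [hq, padicValRat.div (mul_ne_zero (mul_ne_zero (mul_ne_zero (mul_ne_zero hσ0 hsp0) hsm0)
        (mul_ne_zero hϖp0 hϖm0)) (pow_ne_zero 2 htorsQ)) hCK',
      padicValRat.mul (mul_ne_zero (mul_ne_zero (mul_ne_zero hσ0 hsp0) hsm0) (mul_ne_zero hϖp0 hϖm0))
        (pow_ne_zero 2 htorsQ),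
      padicValRat.mul (mul_ne_zero (mul_ne_zero hσ0 hsp0) hsm0) (mul_ne_zero hϖp0 hϖm0),
      padicValRat.mul (mul_ne_zero hσ0 hsp0) hsm0, padicValRat.mul hσ0 hsp0, padicValRat.pow, hvσ, hTam]
    simp only [padicValRat.of_nat, hv]
    ring
  refine ⟨q, hshaAn, ?_⟩
  rw [hvq]
  linarith

end Dictionary



end AddDescentK

end Summit.BirchSwinnertonDyer.BirchSwinnertonDyer.Theorems

end
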